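import Summits.AtomisticToContinuum.BoseEinsteinCondensation.Theorems.BECGroundStateSOSPeriodicIRBoundFsumDefs
import Summits.AtomisticToContinuum.BoseEinsteinCondensation.Theorems.BECGroundStateSOSPeriodicIRBoundWFFormBounds
import Literature.MathematicalPhysics.QuantumManyBody.PeriodicTorusByParts
import HarnessLib

/-!
# Crux `PeriodicIRBound` (stmt-AtomisticToContinuum-3972), line `fsum-phase-pencil`, stub S2
# `stub_phaseConeBlock` — part 2: smooth periodic symmetric multipliers and the density wave `ρ_k†`

For a `C¹`, `Lℤ³`-periodic, permutation-symmetric multiplier `m` on `(ℝ³)^M` with `|m| ≤ A` and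
`|∇m|² ≤ B` pointwise, and a core function `f` (`WF.IsCore`): `m f` is a core function, and
`𝓔_w[m f] ≤ 2A² 𝓔_w[f] + 2B ‖f‖²`, `‖m f‖² ≤ A² ‖f‖²` (product rule and `|a + b|² ≤ 2|a|² + 2|b|²`).
The density wave `G_k(X) = ∑ⱼ e_k(xⱼ)` (`ρ_k† = ` multiplication by `G_k`, `e_k = cellWave L k`) is such a
multiplier: smooth, periodic, symmetric, `|G_k| ≤ M`, `∂_{i,c} G_k = i k̃_c e_k(x_i)`, `|∇G_k|² = M‖k̃‖²`
(`k̃ = waveVector L k`), `conj G_k = G_{-k}`; registered by-product sub-goal `stub_fsumConeMultiplier`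
(the form bound for `G_k f`).
-/

noncomputable section

open MeasureTheory Filter
open scoped ENNReal NNReal ComplexConjugate BigOperators

namespace Summit.AtomisticToContinuum.BoseEinsteinCondensation.Cruxes.PeriodicIRBound.FsumPhasePencil

open Literature.MathematicalPhysics.QuantumManyBody.BoseGas
open Summit.AtomisticToContinuum.BoseEinsteinCondensation.Cruxes.PeriodicIRBound.LinearPhFloorWagner.WF

variable {M : ℕ} {L : ℝ}

/-! ## General multipliers -/

section Multiplier

variable {m f : Config M → ℂ}

/-- The product of a `C¹` periodic symmetric multiplier with a core function is a core function. [folklore] -/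
theorem isCore_mul (hm : ContDiff ℝ 1 m) (hmper : IsTorusPeriodic L m) (hmsymm : IsSymm m)
    (hf : IsCore L f) : IsCore L (fun X => m X * f X) where
  contDiff := hm.mul hf.contDiff
  periodic X i c := by dsimp only; rw [hmper X i c, hf.periodic X i c]
  symm σ X := by dsimp only; rw [hmsymm σ X, hf.symm σ X]

/-- Pointwise kinetic bound for a multiplier: `|∇(m f)|² ≤ 2A²|∇f|² + 2B|f|²` when `|m| ≤ A`, `|∇m|² ≤ B`
at the point. [folklore] -/
theorem kineticDensityReal_mul_le {X : Config M} (hm : DifferentiableAt ℝ m X) (hf : DifferentiableAt ℝ f X)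
    {A B : ℝ} (hA : ‖m X‖ ≤ A) (hB : kineticDensityReal m X ≤ B) :
    kineticDensityReal (fun Y => m Y * f Y) X ≤
      2 * A ^ 2 * kineticDensityReal f X + 2 * B * ‖f X‖ ^ 2 := by
  have hA0 : 0 ≤ A := le_trans (norm_nonneg _) hA
  have hA2 : ‖m X‖ ^ 2 ≤ A ^ 2 := pow_le_pow_left₀ (norm_nonneg _) hA 2
  have hpt : ∀ (i : Fin M) (c : Fin 3),
      ‖fderiv ℝ (fun Y => m Y * f Y) X (Pi.single i (EuclideanSpace.single c (1 : ℝ)))‖ ^ 2 ≤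
        2 * A ^ 2 * ‖fderiv ℝ f X (Pi.single i (EuclideanSpace.single c (1 : ℝ)))‖ ^ 2 +
          2 * (‖fderiv ℝ m X (Pi.single i (EuclideanSpace.single c (1 : ℝ)))‖ ^ 2 * ‖f X‖ ^ 2) := by
    intro i c
    rw [fderiv_mul_apply hm hf]
    set a := fderiv ℝ m X (Pi.single i (EuclideanSpace.single c (1 : ℝ))) with ha
    set b := fderiv ℝ f X (Pi.single i (EuclideanSpace.single c (1 : ℝ))) with hb
    have h1 : ‖a * f X + m X * b‖ ≤ ‖a‖ * ‖f X‖ + ‖m X‖ * ‖b‖ := by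
      calc ‖a * f X + m X * b‖ ≤ ‖a * f X‖ + ‖m X * b‖ := norm_add_le _ _
        _ = ‖a‖ * ‖f X‖ + ‖m X‖ * ‖b‖ := by rw [norm_mul, norm_mul]
    have h2 : ‖a * f X + m X * b‖ ^ 2 ≤ (‖a‖ * ‖f X‖ + ‖m X‖ * ‖b‖) ^ 2 :=
      pow_le_pow_left₀ (norm_nonneg _) h1 2
    have h3 : (‖m X‖ * ‖b‖) ^ 2 ≤ A ^ 2 * ‖b‖ ^ 2 := by
      rw [mul_pow]; exact mul_le_mul_of_nonneg_right hA2 (sq_nonneg _)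
    nlinarith [h2, h3, sq_nonneg (‖a‖ * ‖f X‖ - ‖m X‖ * ‖b‖)]
  unfold kineticDensityReal at hB ⊢
  have hsum : ∑ i : Fin M, ∑ c : Fin 3,
      ‖fderiv ℝ (fun Y => m Y * f Y) X (Pi.single i (EuclideanSpace.single c (1 : ℝ)))‖ ^ 2 ≤
      ∑ i : Fin M, ∑ c : Fin 3,
        (2 * A ^ 2 * ‖fderiv ℝ f X (Pi.single i (EuclideanSpace.single c (1 : ℝ)))‖ ^ 2 +
          2 * (‖fderiv ℝ m X (Pi.single i (EuclideanSpace.single c (1 : ℝ)))‖ ^ 2 * ‖f X‖ ^ 2)) :=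
    Finset.sum_le_sum fun i _ => Finset.sum_le_sum fun c _ => hpt i c
  have heq : ∑ i : Fin M, ∑ c : Fin 3,
      (2 * A ^ 2 * ‖fderiv ℝ f X (Pi.single i (EuclideanSpace.single c (1 : ℝ)))‖ ^ 2 +
        2 * (‖fderiv ℝ m X (Pi.single i (EuclideanSpace.single c (1 : ℝ)))‖ ^ 2 * ‖f X‖ ^ 2)) =
      2 * A ^ 2 * (∑ i : Fin M, ∑ c : Fin 3,
          ‖fderiv ℝ f X (Pi.single i (EuclideanSpace.single c (1 : ℝ)))‖ ^ 2) +
        2 * (∑ i : Fin M, ∑ c : Fin 3,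
          ‖fderiv ℝ m X (Pi.single i (EuclideanSpace.single c (1 : ℝ)))‖ ^ 2) * ‖f X‖ ^ 2 := by
    rw [Finset.mul_sum, Finset.mul_sum, Finset.sum_mul, ← Finset.sum_add_distrib]
    refine Finset.sum_congr rfl fun i _ => ?_
    rw [Finset.mul_sum, Finset.mul_sum, Finset.sum_mul, ← Finset.sum_add_distrib]
    refine Finset.sum_congr rfl fun c _ => ?_
    ring
  rw [heq] at hsum
  have hf2 : 0 ≤ ‖f X‖ ^ 2 := sq_nonneg _
  nlinarith [hsum, mul_le_mul_of_nonneg_right hB hf2]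

/-- The same bound in `ℝ≥0∞`: `kineticDensity (m f) ≤ 2A² kineticDensity f + 2B |f|²`. [folklore] -/
theorem kineticDensity_mul_le {X : Config M} (hm : DifferentiableAt ℝ m X) (hf : DifferentiableAt ℝ f X)
    {A B : ℝ} (hA : ‖m X‖ ≤ A) (hB : kineticDensityReal m X ≤ B) :
    kineticDensity (fun Y => m Y * f Y) X ≤
      ENNReal.ofReal (2 * A ^ 2) * kineticDensity f X + ENNReal.ofReal (2 * B) * ((‖f X‖₊ : ℝ≥0∞)) ^ 2 := by
  have hB0 : 0 ≤ B := le_trans (kineticDensityReal_nonneg m X) hB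
  rw [kineticDensity_eq_ofReal, kineticDensity_eq_ofReal, coe_nnnorm_sq_eq_ofReal,
    ← ENNReal.ofReal_mul (by positivity), ← ENNReal.ofReal_mul (by positivity),
    ← ENNReal.ofReal_add (mul_nonneg (by positivity) (kineticDensityReal_nonneg f X)) (by positivity)]
  exact ENNReal.ofReal_le_ofReal (kineticDensityReal_mul_le hm hf hA hB)

/-- `|m f|² ≤ A² |f|²` in `ℝ≥0∞`. [folklore] -/
theorem coe_nnnorm_mul_sq_le {X : Config M} {A : ℝ} (hA : ‖m X‖ ≤ A) :
    ((‖m X * f X‖₊ : ℝ≥0∞)) ^ 2 ≤ ENNReal.ofReal (A ^ 2) * ((‖f X‖₊ : ℝ≥0∞)) ^ 2 := by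
  rw [coe_nnnorm_sq_eq_ofReal, coe_nnnorm_sq_eq_ofReal, ← ENNReal.ofReal_mul (sq_nonneg _), norm_mul,
    mul_pow]
  exact ENNReal.ofReal_le_ofReal
    (mul_le_mul_of_nonneg_right (pow_le_pow_left₀ (norm_nonneg _) hA 2) (sq_nonneg _))

/-- `‖m f‖² ≤ A² ‖f‖²`. [folklore] -/
theorem normSq_mul_le (L : ℝ) {A : ℝ} (hA : ∀ X, ‖m X‖ ≤ A) :
    normSq L (fun X => m X * f X) ≤ ENNReal.ofReal (A ^ 2) * normSq L f := by
  unfold normSq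
  rw [← lintegral_const_mul' _ _ ENNReal.ofReal_ne_top]
  exact lintegral_mono fun X => coe_nnnorm_mul_sq_le (hA X)

/-- `P_w[m f] ≤ A² P_w[f]`. [folklore] -/
theorem potForm_mul_le (w : ℝ → ℝ≥0∞) (L : ℝ) {A : ℝ} (hA : ∀ X, ‖m X‖ ≤ A) :
    potForm w L (fun X => m X * f X) ≤ ENNReal.ofReal (A ^ 2) * potForm w L f := by
  unfold potForm
  rw [← lintegral_const_mul' _ _ ENNReal.ofReal_ne_top]
  refine lintegral_mono fun X => ?_
  calc periodicInteraction w L X * ((‖m X * f X‖₊ : ℝ≥0∞)) ^ 2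
      ≤ periodicInteraction w L X * (ENNReal.ofReal (A ^ 2) * ((‖f X‖₊ : ℝ≥0∞)) ^ 2) :=
        mul_le_mul_right (coe_nnnorm_mul_sq_le (hA X)) _
    _ = ENNReal.ofReal (A ^ 2) * (periodicInteraction w L X * ((‖f X‖₊ : ℝ≥0∞)) ^ 2) := by ring

/-- **Form bound for a multiplier**: `𝓔_w[m f] ≤ 2A² 𝓔_w[f] + 2B ‖f‖²` for differentiable `m, f` with
`|m| ≤ A`, `|∇m|² ≤ B`. [folklore] -/
theorem qform_mul_le (w : ℝ → ℝ≥0∞) (L : ℝ) (hm : Differentiable ℝ m) (hf : Differentiable ℝ f)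
    {A B : ℝ} (hA : ∀ X, ‖m X‖ ≤ A) (hB : ∀ X, kineticDensityReal m X ≤ B) :
    qform w L (fun X => m X * f X) ≤
      ENNReal.ofReal (2 * A ^ 2) * qform w L f + ENNReal.ofReal (2 * B) * normSq L f := by
  rw [qform_eq_lintegral_kineticDensity_add_potForm, qform_eq_lintegral_kineticDensity_add_potForm, mul_add]
  have hkin : (∫⁻ X in cellN M L, kineticDensity (fun Y => m Y * f Y) X) ≤
      ENNReal.ofReal (2 * A ^ 2) * (∫⁻ X in cellN M L, kineticDensity f X) +
        ENNReal.ofReal (2 * B) * normSq L f := by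
    unfold normSq
    rw [← lintegral_const_mul' _ _ ENNReal.ofReal_ne_top, ← lintegral_const_mul' _ _ ENNReal.ofReal_ne_top,
      ← lintegral_add_left ((measurable_kineticDensity_fb f).const_mul _)]
    exact lintegral_mono fun X => kineticDensity_mul_le (hm X) (hf X) (hA X) (hB X)
  have hpot : potForm w L (fun X => m X * f X) ≤ ENNReal.ofReal (2 * A ^ 2) * potForm w L f :=
    le_trans (potForm_mul_le w L hA)
      (mul_le_mul_left (ENNReal.ofReal_le_ofReal (by nlinarith [sq_nonneg A])) _)
  calc (∫⁻ X in cellN M L, kineticDensity (fun Y => m Y * f Y) X) + potForm w L (fun X => m X * f X)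
      ≤ (ENNReal.ofReal (2 * A ^ 2) * (∫⁻ X in cellN M L, kineticDensity f X) +
          ENNReal.ofReal (2 * B) * normSq L f) + ENNReal.ofReal (2 * A ^ 2) * potForm w L f :=
        add_le_add hkin hpot
    _ = _ := by ring

/-- `𝓔_w[m f] < ∞` for a bounded multiplier with bounded gradient and `f` continuous with finite form. [folklore] -/
theorem qform_mul_ne_top (w : ℝ → ℝ≥0∞) (L : ℝ) (hm : Differentiable ℝ m) (hf : Differentiable ℝ f)
    {A B : ℝ} (hA : ∀ X, ‖m X‖ ≤ A) (hB : ∀ X, kineticDensityReal m X ≤ B) (hfE : qform w L f ≠ ⊤) :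
    qform w L (fun X => m X * f X) ≠ ⊤ :=
  ne_top_of_le_ne_top (ENNReal.add_ne_top.2 ⟨ENNReal.mul_ne_top ENNReal.ofReal_ne_top hfE,
    ENNReal.mul_ne_top ENNReal.ofReal_ne_top (lintegral_cellN_sq_lt_top L hf.continuous).ne⟩)
    (qform_mul_le w L hm hf hA hB)

end Multiplier

/-! ## The density wave `G_k = ∑ⱼ e_k(xⱼ)` -/

section DensityWave

variable (L : ℝ) (k : Fin 3 → ℤ)

/-- `k̃ = (2π/L)·k`, the form of the wave vector used by the torus calculus files. [folklore] -/
theorem waveVector_eq_smul (L : ℝ) (k : Fin 3 → ℤ) : waveVector L k = (2 * Real.pi / L) • latticeVec 1 k := by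
  ext j
  simp only [waveVector_apply, latticeVec, PiLp.smul_apply, smul_eq_mul]
  ring

/-- `G_k` is smooth. [folklore] -/
theorem contDiff_densityWave {n : ℕ∞} : ContDiff ℝ n (fun X : Config M => ∑ j, cellWave L k (X j)) :=
  ContDiff.sum fun j _ => contDiff_cellWave_comp_apply L k j

/-- `G_k` is differentiable. [folklore] -/
theorem differentiable_densityWave : Differentiable ℝ (fun X : Config M => ∑ j, cellWave L k (X j)) :=
  (contDiff_densityWave (n := 1) L k).differentiable (by simp)

/-- `G_k` is `Lℤ³`-periodic in every particle. [folklore] -/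
theorem isTorusPeriodic_densityWave {L : ℝ} (hL : 0 < L) (k : Fin 3 → ℤ) :
    IsTorusPeriodic L (fun X : Config M => ∑ j, cellWave L k (X j)) := by
  intro X i c
  refine Finset.sum_congr rfl fun j _ => ?_
  rw [Pi.add_apply]
  by_cases hji : j = i
  · subst hji
    rw [Pi.single_eq_same, cellWave_periodic hL.ne']
  · rw [Pi.single_eq_of_ne hji, add_zero]

/-- `G_k` is permutation-symmetric. [folklore] -/
theorem isSymm_densityWave : IsSymm (fun X : Config M => ∑ j, cellWave L k (X j)) :=
  fun σ X => Equiv.sum_comp σ (fun j => cellWave L k (X j))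

/-- `|G_k| ≤ M`. [folklore] -/
theorem norm_densityWave_le (X : Config M) : ‖∑ j, cellWave L k (X j)‖ ≤ M := by
  calc ‖∑ j, cellWave L k (X j)‖ ≤ ∑ j : Fin M, ‖cellWave L k (X j)‖ := norm_sum_le _ _
    _ = M := by simp [norm_cellWave]

/-- `∂_{i,c} G_k = i k̃_c e_k(x_i)`. [folklore] -/
theorem fderiv_densityWave (X : Config M) (i : Fin M) (c : Fin 3) :
    fderiv ℝ (fun Y : Config M => ∑ j, cellWave L k (Y j)) X (Pi.single i (EuclideanSpace.single c (1 : ℝ))) =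
      Complex.I * (waveVector L k c : ℂ) * cellWave L k (X i) := by
  rw [fderiv_finset_sum_apply _ (fun j _ => differentiable_cellWave_comp_apply L k j X)]
  simp_rw [fderiv_cellWave_comp_apply_single_single L k _ i c X (waveVector_eq_smul L k)]
  rw [Finset.sum_ite_eq' Finset.univ i, if_pos (Finset.mem_univ i)]

/-- `|∇G_k|² = M ‖k̃‖²`. [folklore] -/
theorem kineticDensityReal_densityWave (X : Config M) :
    kineticDensityReal (fun Y : Config M => ∑ j, cellWave L k (Y j)) X = M * ‖waveVector L k‖ ^ 2 := by
  unfold kineticDensityReal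
  simp_rw [fderiv_densityWave L k X]
  have h : ∀ (i : Fin M) (c : Fin 3),
      ‖Complex.I * (waveVector L k c : ℂ) * cellWave L k (X i)‖ ^ 2 = (waveVector L k c) ^ 2 := by
    intro i c
    rw [norm_mul, norm_mul, Complex.norm_I, one_mul, norm_cellWave, mul_one, Complex.norm_real,
      Real.norm_eq_abs, sq_abs]
  simp_rw [h]
  rw [Finset.sum_const, Finset.card_univ, Fintype.card_fin, nsmul_eq_mul, EuclideanSpace.real_norm_sq_eq]

/-- `conj G_k = G_{-k}`. [folklore] -/
theorem conj_densityWave (X : Config M) : conj (∑ j, cellWave L k (X j)) = ∑ j, cellWave L (-k) (X j) := by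
  rw [map_sum]
  exact Finset.sum_congr rfl fun j _ => conj_cellWave L k (X j)

/-- `‖(-k)̃‖ = ‖k̃‖`. [folklore] -/
theorem norm_waveVector_neg : ‖waveVector L (-k)‖ = ‖waveVector L k‖ := by
  rw [waveVector_neg, norm_neg]

end DensityWave

/-! ## The density wave as a multiplier -/

section DensityWaveMul

variable {f : Config M → ℂ}

/-- `G_k f` is a core function when `f` is. [folklore] -/
theorem isCore_densityWave_mul (hL : 0 < L) (k : Fin 3 → ℤ) (hf : IsCore L f) :
    IsCore L (fun X => (∑ j, cellWave L k (X j)) * f X) :=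
  isCore_mul (contDiff_densityWave L k) (isTorusPeriodic_densityWave hL k) (isSymm_densityWave L k) hf

/-- `conj(G_k) f` is a core function when `f` is. [folklore] -/
theorem isCore_conj_densityWave_mul (hL : 0 < L) (k : Fin 3 → ℤ) (hf : IsCore L f) :
    IsCore L (fun X => conj (∑ j, cellWave L k (X j)) * f X) := by
  simp_rw [conj_densityWave]
  exact isCore_densityWave_mul hL (-k) hf

/-- **Form bound for the density wave**: `𝓔_w[G_k f] ≤ 2M² 𝓔_w[f] + 2M‖k̃‖² ‖f‖²`. [folklore] -/
theorem qform_densityWave_mul_le (w : ℝ → ℝ≥0∞) (L : ℝ) (k : Fin 3 → ℤ) (hf : Differentiable ℝ f) :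
    qform w L (fun X => (∑ j, cellWave L k (X j)) * f X) ≤
      ENNReal.ofReal (2 * (M : ℝ) ^ 2) * qform w L f +
        ENNReal.ofReal (2 * (M * ‖waveVector L k‖ ^ 2)) * normSq L f :=
  qform_mul_le w L (differentiable_densityWave L k) hf (norm_densityWave_le L k)
    (fun X => (kineticDensityReal_densityWave L k X).le)

/-- `𝓔_w[conj(G_k) f] ≤ 2M² 𝓔_w[f] + 2M‖k̃‖² ‖f‖²`. [folklore] -/
theorem qform_conj_densityWave_mul_le (w : ℝ → ℝ≥0∞) (L : ℝ) (k : Fin 3 → ℤ) (hf : Differentiable ℝ f) :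
    qform w L (fun X => conj (∑ j, cellWave L k (X j)) * f X) ≤
      ENNReal.ofReal (2 * (M : ℝ) ^ 2) * qform w L f +
        ENNReal.ofReal (2 * (M * ‖waveVector L k‖ ^ 2)) * normSq L f := by
  simp_rw [conj_densityWave]
  rw [← norm_waveVector_neg L k]
  exact qform_densityWave_mul_le w L (-k) hf

/-- `‖G_k f‖² ≤ M² ‖f‖²`. [folklore] -/
theorem normSq_densityWave_mul_le (L : ℝ) (k : Fin 3 → ℤ) (f : Config M → ℂ) :
    normSq L (fun X => (∑ j, cellWave L k (X j)) * f X) ≤ ENNReal.ofReal ((M : ℝ) ^ 2) * normSq L f :=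
  normSq_mul_le L (norm_densityWave_le L k)

/-- `‖conj(G_k) f‖² ≤ M² ‖f‖²`. [folklore] -/
theorem normSq_conj_densityWave_mul_le (L : ℝ) (k : Fin 3 → ℤ) (f : Config M → ℂ) :
    normSq L (fun X => conj (∑ j, cellWave L k (X j)) * f X) ≤ ENNReal.ofReal ((M : ℝ) ^ 2) * normSq L f := by
  simp_rw [conj_densityWave]
  exact normSq_densityWave_mul_le L (-k) f

/-- `𝓔_w[G_k f] < ∞` when `𝓔_w[f] < ∞` (`f` differentiable). [folklore] -/
theorem qform_densityWave_mul_ne_top (w : ℝ → ℝ≥0∞) (L : ℝ) (k : Fin 3 → ℤ) (hf : Differentiable ℝ f)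
    (hfE : qform w L f ≠ ⊤) : qform w L (fun X => (∑ j, cellWave L k (X j)) * f X) ≠ ⊤ :=
  qform_mul_ne_top w L (differentiable_densityWave L k) hf (norm_densityWave_le L k)
    (fun X => (kineticDensityReal_densityWave L k X).le) hfE

/-- `𝓔_w[conj(G_k) f] < ∞` when `𝓔_w[f] < ∞`. [folklore] -/
theorem qform_conj_densityWave_mul_ne_top (w : ℝ → ℝ≥0∞) (L : ℝ) (k : Fin 3 → ℤ) (hf : Differentiable ℝ f)
    (hfE : qform w L f ≠ ⊤) : qform w L (fun X => conj (∑ j, cellWave L k (X j)) * f X) ≠ ⊤ := by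
  simp_rw [conj_densityWave]
  exact qform_densityWave_mul_ne_top w L (-k) hf hfE

/-- **Registered by-product sub-goal `stub_fsumConeMultiplier`** (line `fsum-phase-pencil`, helper of S2
`stub_phaseConeBlock`): the form bound for the density wave `ρ_k†f = G_k f`. [folklore] -/
theorem stub_fsumConeMultiplier : ∀ {M : ℕ} (w : ℝ → ℝ≥0∞) (L : ℝ) (k : Fin 3 → ℤ) {f : Config M → ℂ}, Differentiable ℝ f → qform w L (fun X => (∑ j, cellWave L k (X j)) * f X) ≤ ENNReal.ofReal (2 * (M : ℝ) ^ 2) * qform w L f + ENNReal.ofReal (2 * (M * ‖waveVector L k‖ ^ 2)) * normSq L f :=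
  fun w L k _ hf => qform_densityWave_mul_le w L k hf

end DensityWaveMul

end Summit.AtomisticToContinuum.BoseEinsteinCondensation.Cruxes.PeriodicIRBound.FsumPhasePencil

end
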